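import Summits.QuantumFields.YangMills.Theorems.BalabanUVNodesN21ProjectedCentreNonCollapse

/-!
# N21 (NE7c) · AGMON ∕ CACCIOPPOLI for the block OBSTACLE problem — coercivity + decay, no maximum principle (lens Card 86 ∕ ROW P‴)

R134 seat pub-ymgap-dag-n21-d (g8), node N21 = NE7c (single-run shell-weight bound, NOT PRINTED in [Bałaban 1983–89],
NOT proved), lane K3⁷ `SpineGivenEndpointR13SepCoPH` (stmt-QuantumFields-20544, `--kind proof --supports … --as helper`).
Part 33 of the comparison series.  THIS FILE = §C of the lens's `Sketch-nearmiss-g29.lean` (LENS-nearmiss v29.0 ROW P‴; first refusal dag-n21-d) — farm rc 0 · 0 warnings at the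
lens desk — VERBATIM, statements and proofs, re-homed in this namespace.  AUTHORSHIP OF THE MATHEMATICS: planner seat
`ym-lens-BalabanUVNodes-nearmiss` g29 (memo-only seat, cannot file); this seat only files.  Imports part 32 (§A + §B) for `dotMulVec_symm_swap`.

WHAT (lens Card 86) — the one new estimate the A-projected centre needs (core reading of `m_K`).  With `e := m_K − m`
minimising `⟨e,Ae⟩` over the box `Π_b [lo_b, hi_b]` and a weight `η` supported where the box contains `0` (the DEEP sites):
the competitor `(1 − tη²)⊙e` is feasible (`shrink_mem_box`), so `⟨e, A(η²e)⟩ ≤ 0` (`weightedShrink_firstOrder`); with the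
commutator identity `⟨ηe, A(ηe)⟩ = ⟨e, A(η²e)⟩ − ½ Σ A_xy e_x e_y (η_x − η_y)²` (`weight_comm_identity`) the weighted energy is
paid by the commutator alone (`weightedEnergy_le_comm`, `weightedNorm_le_comm`) — coercivity + off-diagonal decay of `A` then
give exponential decay of `e` into the block from the violated layer (the iteration is words; located letters γ₀, (Γ₀, δ):
desk ROW Q′).

HONEST FRAMING.  [textbook] linear algebra ∕ convexity ∕ measurability; 0 def, 0 sorry; nothing of Bałaban's asserted; NE7c NOT
PRINTED ∕ NOT proved; N21 NOT discharged; counts unmoved (typed 28∕28 · discharged 5∕27); count-neutral; one finite 𝕋⁴ at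
fixed ε — nothing about ℝ⁴ ∕ OS ∕ mass gap ∕ Clay.
-/

open Set Matrix

namespace Summit.QuantumFields.YangMills.Theorems.N21BoxObstacleDecay

open Summit.QuantumFields.YangMills.Theorems.N21ProjectedCentreNonCollapse (dotMulVec_symm_swap)

/-! ## §C  Card 86 — Agmon ∕ Caccioppoli for the box obstacle problem (coercivity + decay, no maximum principle) -/

section Agmon

variable {κ : Type*} [Fintype κ]

omit [Fintype κ] in
/-- **THE SHRUNK COMPETITOR IS FEASIBLE.**  On the box `Π_b [lo_b, hi_b]`, shrinking `e` coordinatewise by factors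
`1 − tη_b² ∈ [0,1]` stays in the box provided the box contains `0` wherever `η ≠ 0` (deep sites: `|m_b| ≤ θ_b`).
[textbook] -/
theorem shrink_mem_box (lo hi e η : κ → ℝ) (he : ∀ b, lo b ≤ e b ∧ e b ≤ hi b)
    (hη : ∀ b, η b ≠ 0 → lo b ≤ 0 ∧ 0 ≤ hi b) {t : ℝ} (ht0 : 0 ≤ t) (ht : ∀ b, t * η b ^ 2 ≤ 1) (b : κ) :
    lo b ≤ (1 - t * η b ^ 2) * e b ∧ (1 - t * η b ^ 2) * e b ≤ hi b := by
  obtain ⟨h1, h2⟩ := he b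
  by_cases hb : η b = 0
  · simp [hb, h1, h2]
  · obtain ⟨hlo, hhi⟩ := hη b hb
    have hs0 : 0 ≤ 1 - t * η b ^ 2 := by linarith [ht b]
    have hs1 : 0 ≤ t * η b ^ 2 := mul_nonneg ht0 (sq_nonneg _)
    by_cases he0 : 0 ≤ e b
    · exact ⟨hlo.trans (mul_nonneg hs0 he0), by nlinarith⟩
    · rw [not_le] at he0
      exact ⟨by nlinarith, (mul_nonpos_iff.2 (Or.inl ⟨hs0, he0.le⟩)).trans hhi⟩

/-- **FIRST-ORDER CONDITION AGAINST DEEP-SUPPORTED WEIGHTS (the Agmon∕Caccioppoli test).**  If `e` minimises `⟨v,Av⟩`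
over the box (`A` symmetric) and `η` vanishes off the deep sites, then `⟨e, A(η²e)⟩ ≤ 0` — first variation towards
the feasible competitor `(1 − tη²)⊙e`, `t ↓ 0`. [textbook: Kinderlehrer–Stampacchia (variational inequalities);
Agmon ∕ Combes–Thomas weights] -/
theorem weightedShrink_firstOrder (A : Matrix κ κ ℝ) (hA : A.IsSymm) (lo hi e : κ → ℝ)
    (he : ∀ b, lo b ≤ e b ∧ e b ≤ hi b)
    (hmin : ∀ v : κ → ℝ, (∀ b, lo b ≤ v b ∧ v b ≤ hi b) → e ⬝ᵥ (A *ᵥ e) ≤ v ⬝ᵥ (A *ᵥ v))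
    (η : κ → ℝ) (hη : ∀ b, η b ≠ 0 → lo b ≤ 0 ∧ 0 ≤ hi b) :
    e ⬝ᵥ (A *ᵥ (η * η * e)) ≤ 0 := by
  set f : κ → ℝ := η * η * e with hf
  have hexp : ∀ t : ℝ, (e - t • f) ⬝ᵥ (A *ᵥ (e - t • f))
      = e ⬝ᵥ (A *ᵥ e) - 2 * t * (e ⬝ᵥ (A *ᵥ f)) + t ^ 2 * (f ⬝ᵥ (A *ᵥ f)) := by
    intro t
    simp only [Matrix.mulVec_sub, Matrix.mulVec_smul, dotProduct_sub, sub_dotProduct, dotProduct_smul,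
      smul_dotProduct, smul_eq_mul]
    rw [dotMulVec_symm_swap A hA f e]
    ring
  set M : ℝ := ∑ b, η b ^ 2 + 1 with hM
  have hsum0 : 0 ≤ ∑ b, η b ^ 2 := Finset.sum_nonneg fun b _ => sq_nonneg (η b)
  have hMpos : 0 < M := by linarith
  have hMge : ∀ b, η b ^ 2 ≤ M := fun b => by
    have h := Finset.single_le_sum (fun b _ => sq_nonneg (η b)) (Finset.mem_univ b)
    linarith
  have hfeas : ∀ t ∈ Icc (0 : ℝ) (1 / M), ∀ b, lo b ≤ (e - t • f) b ∧ (e - t • f) b ≤ hi b := by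
    intro t ht b
    have ht1 : ∀ b, t * η b ^ 2 ≤ 1 := fun b => by
      calc t * η b ^ 2 ≤ 1 / M * M := mul_le_mul ht.2 (hMge b) (sq_nonneg _) (by positivity)
        _ = 1 := by field_simp
    have hb : (e - t • f) b = (1 - t * η b ^ 2) * e b := by
      simp only [hf, Pi.sub_apply, Pi.smul_apply, Pi.mul_apply, smul_eq_mul]
      ring
    rw [hb]
    exact shrink_mem_box lo hi e η he hη ht.1 ht1 b
  have hineq : ∀ t ∈ Icc (0 : ℝ) (1 / M),
      0 ≤ -(2 * t * (e ⬝ᵥ (A *ᵥ f))) + t ^ 2 * (f ⬝ᵥ (A *ᵥ f)) := by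
    intro t ht
    have h := hmin _ (hfeas t ht)
    rw [hexp t] at h
    linarith
  set a := e ⬝ᵥ (A *ᵥ f) with ha
  set b := f ⬝ᵥ (A *ᵥ f) with hb
  by_contra hpos
  rw [not_le] at hpos
  have ht0 : 0 < a / (|b| + 1) := div_pos hpos (by positivity)
  set t := min (1 / M) (a / (|b| + 1)) with ht
  have htpos : 0 < t := lt_min (by positivity) ht0
  have ht1 : t ≤ 1 / M := min_le_left _ _
  have ht2 : t ≤ a / (|b| + 1) := min_le_right _ _
  have htb : t * (|b| + 1) ≤ a := by
    have h := mul_le_mul_of_nonneg_right ht2 (by positivity : (0 : ℝ) ≤ |b| + 1)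
    rwa [div_mul_cancel₀ _ (by positivity : (|b| + 1 : ℝ) ≠ 0)] at h
  have h := hineq t ⟨htpos.le, ht1⟩
  have hb' : b ≤ |b| := le_abs_self b
  nlinarith [mul_nonneg (sq_nonneg t) (sub_nonneg.2 hb'), mul_le_mul_of_nonneg_left htb htpos.le,
    mul_pos htpos hpos, sq_nonneg t]

/-- **COMMUTATOR IDENTITY** (discrete `∫|∇(ηe)|² = ∫ ∇e·∇(η²e) + ∫ e²|∇η|²`; the sign in front of the commutator is
that of the off-diagonal entries): `⟨ηe, A(ηe)⟩ = ⟨e, A(η²e)⟩ − ½ Σ_x Σ_y A_xy e_x e_y (η_x − η_y)²`. [textbook] -/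
theorem weight_comm_identity (A : Matrix κ κ ℝ) (hA : A.IsSymm) (e η : κ → ℝ) :
    (η * e) ⬝ᵥ (A *ᵥ (η * e))
      = e ⬝ᵥ (A *ᵥ (η * η * e)) - 1 / 2 * ∑ x, ∑ y, A x y * (e x * e y) * (η x - η y) ^ 2 := by
  have hswap : ∑ x, ∑ y, A x y * (e x * e y) * η y ^ 2 = ∑ x, ∑ y, A x y * (e x * e y) * η x ^ 2 := by
    rw [Finset.sum_comm]
    refine Finset.sum_congr rfl fun x _ => Finset.sum_congr rfl fun y _ => ?_
    rw [hA.apply x y]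
    ring
  have hL : (η * e) ⬝ᵥ (A *ᵥ (η * e)) = ∑ x, ∑ y, A x y * (e x * e y) * (η x * η y) := by
    simp only [dotProduct, Matrix.mulVec, Pi.mul_apply, Finset.mul_sum]
    refine Finset.sum_congr rfl fun x _ => Finset.sum_congr rfl fun y _ => ?_
    ring
  have hR : e ⬝ᵥ (A *ᵥ (η * η * e)) = ∑ x, ∑ y, A x y * (e x * e y) * η y ^ 2 := by
    simp only [dotProduct, Matrix.mulVec, Pi.mul_apply, Finset.mul_sum]
    refine Finset.sum_congr rfl fun x _ => Finset.sum_congr rfl fun y _ => ?_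
    ring
  have h2 : ∑ x, ∑ y, A x y * (e x * e y) * (η x - η y) ^ 2
      = 2 * ∑ x, ∑ y, A x y * (e x * e y) * η x ^ 2
        - 2 * ∑ x, ∑ y, A x y * (e x * e y) * (η x * η y) := by
    have hpt : ∀ x y, A x y * (e x * e y) * (η x - η y) ^ 2
        = (A x y * (e x * e y) * η x ^ 2 + A x y * (e x * e y) * η y ^ 2)
          - 2 * (A x y * (e x * e y) * (η x * η y)) := by
      intros; ring
    simp only [hpt, Finset.sum_sub_distrib, Finset.sum_add_distrib, ← Finset.mul_sum, hswap]
    ring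
  rw [hL, hR, hswap, h2]
  ring

/-- **AGMON ∕ CACCIOPPOLI INEQUALITY FOR THE BOX OBSTACLE PROBLEM.**  The weighted energy of the minimiser is paid by
the commutator alone: `⟨ηe, A(ηe)⟩ ≤ ½ Σ |A_xy|·|e_x||e_y|·(η_x − η_y)²` for every weight `η` vanishing off the deep
sites.  With `γ‖ηe‖² ≤ ⟨ηe,A(ηe)⟩`, `|A_xy| ≤ Γ₀e^{−δ|x−y|}` and an exponential weight `η = e^{α d(·)}` (`α` small
against `δ` and `Γ₀∕γ`) this is the exponential decay of the projection's displacement `e = m_K − m` into the block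
from the violated layer — NO maximum principle, NO M-matrix structure. [textbook] -/
theorem weightedEnergy_le_comm (A : Matrix κ κ ℝ) (hA : A.IsSymm) (lo hi e : κ → ℝ)
    (he : ∀ b, lo b ≤ e b ∧ e b ≤ hi b)
    (hmin : ∀ v : κ → ℝ, (∀ b, lo b ≤ v b ∧ v b ≤ hi b) → e ⬝ᵥ (A *ᵥ e) ≤ v ⬝ᵥ (A *ᵥ v))
    (η : κ → ℝ) (hη : ∀ b, η b ≠ 0 → lo b ≤ 0 ∧ 0 ≤ hi b) :
    (η * e) ⬝ᵥ (A *ᵥ (η * e)) ≤ 1 / 2 * ∑ x, ∑ y, |A x y| * (|e x| * |e y|) * (η x - η y) ^ 2 := by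
  rw [weight_comm_identity A hA e η]
  have h1 := weightedShrink_firstOrder A hA lo hi e he hmin η hη
  have h2 : -(∑ x, ∑ y, A x y * (e x * e y) * (η x - η y) ^ 2)
      ≤ ∑ x, ∑ y, |A x y| * (|e x| * |e y|) * (η x - η y) ^ 2 := by
    rw [← Finset.sum_neg_distrib]
    refine Finset.sum_le_sum fun x _ => ?_
    rw [← Finset.sum_neg_distrib]
    refine Finset.sum_le_sum fun y _ => ?_
    have hxy : -(A x y * (e x * e y)) ≤ |A x y| * (|e x| * |e y|) := by
      rw [← abs_mul, ← abs_mul]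
      exact neg_le_abs _
    calc -(A x y * (e x * e y) * (η x - η y) ^ 2) = -(A x y * (e x * e y)) * (η x - η y) ^ 2 := by ring
      _ ≤ |A x y| * (|e x| * |e y|) * (η x - η y) ^ 2 := mul_le_mul_of_nonneg_right hxy (sq_nonneg _)
  linarith

/-- **COERCIVE FORM OF THE AGMON INEQUALITY** (`γ`-coercivity in any norm): `γ‖ηe‖² ≤ ½ Σ |A_xy||e_x||e_y|(η_x−η_y)²`. -/
theorem weightedNorm_le_comm (A : Matrix κ κ ℝ) (hA : A.IsSymm) {γ : ℝ}
    (hγ : ∀ x : κ → ℝ, γ * ‖x‖ ^ 2 ≤ x ⬝ᵥ (A *ᵥ x)) (lo hi e : κ → ℝ)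
    (he : ∀ b, lo b ≤ e b ∧ e b ≤ hi b)
    (hmin : ∀ v : κ → ℝ, (∀ b, lo b ≤ v b ∧ v b ≤ hi b) → e ⬝ᵥ (A *ᵥ e) ≤ v ⬝ᵥ (A *ᵥ v))
    (η : κ → ℝ) (hη : ∀ b, η b ≠ 0 → lo b ≤ 0 ∧ 0 ≤ hi b) :
    γ * ‖η * e‖ ^ 2 ≤ 1 / 2 * ∑ x, ∑ y, |A x y| * (|e x| * |e y|) * (η x - η y) ^ 2 :=
  (hγ (η * e)).trans (weightedEnergy_le_comm A hA lo hi e he hmin η hη)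

end Agmon

end Summit.QuantumFields.YangMills.Theorems.N21BoxObstacleDecay
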